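import Literature.AnabelianGeometry.AbsoluteAnabelian.CurveModelFactsNonVacuity
import HarnessLib

/-!
# [AbsCusp] Proposition 2.2 (ii) relative to a curve model (`AbsCusp.Prop_2_2_ii_model`) — HEAD-MATCHED
# INSTANCE FORMS (FACT-LIST row F-0044), PROOF-ONLY

S. Mochizuki, *Absolute anabelian cuspidalizations of proper hyperbolic curves*, J. Math. Kyoto Univ. **47**
(2007) 451–539, Prop. 2.2 (ii) p. 39: "Suppose that `Σ = 𝔓𝔯𝔦𝔪𝔢𝔰`. Then … (ii) the map `x ↦ D_x` from `X^{cl}` to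
conjugacy classes of closed subgroups of `Π_X` is injective, i.e., `X` is `𝔓𝔯𝔦𝔪𝔢𝔰`-separated."
[cite: MochizukiAbsCusp2007, Prop 2.2 (ii) p.39]

PROOF-ONLY companion of `AbsCuspSeparated.lean` (cell abc-iut, block F, seat abc-iut-f-020, KEY INST59A; FROZEN
FACT-LIST row F-0044 `AbsCusp.Prop_2_2_ii_model`; 0 `def`, 0 `instance`, 0 `structure`; nothing restated).  The
row is a SCHEMA over the curve-model interface `M : AbsTopIII.CurveModel` (no étale `π₁` in the tree): its
universal closure over all `M` is false (abc-iut-f-056, `AbsCuspSeparatedProofs.not_forall_prop_2_2_ii_model`),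
and the positive evidence of record is a CONJUNCTION — the last conjunct of abc-iut-f-056's
`AbsTopIII.CurveModel.facts_of_decomp_eq_top` / `exists_facts_nonVacuous` (`CurveModelFactsNonVacuity.lean`) —
so no theorem of the tree has `Prop_2_2_ii_model` as its conclusion HEAD.  This file supplies the head-matched
forms: (1) the DEGENERACY CRITERION as a conditional closer — at an interface in which every decomposition group
of a closed point is all of `Π`, every curve has at most one closed point and no curve has a cusp, every curve
is `𝔓𝔯𝔦𝔪𝔢𝔰`-separated, so `Prop_2_2_ii_model M` holds; (2) the unconditional instance at THE non-vacuous
witness interface of `exists_facts_nonVacuous p` (one proper scheme-like curve over the MLF `ℚ_p`, `Π = G_{ℚ_p}`,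
one closed point with `D = Π`, no cusps), named by `Exists.choose`.

HONEST LABEL: degenerate junk interfaces, not models of any hyperbolic curve; statements about OUR typing (the
hypothesis `h22 : Prop_2_2_ii_model M` that consumers bind is satisfiable, non-vacuously), nothing about print,
whose content (Kummer theory of the Jacobian, [Tama] Cor. 2.10) is not in the tree.  Nothing here bears on
[IUTchIII] Cor. 3.12; typed ≠ proved.
-/

noncomputable section

open scoped Classical Pointwise

namespace Literature.AnabelianGeometry.AbsoluteAnabelian

open AbsTopIII CategoryTheory

universe u

namespace AbsCusp

/-- **F-0044, conditional closer (degeneracy criterion)**: if every decomposition group of a closed point of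
every curve of `M` is all of `Π`, every curve has at most one closed point and no curve has a cusp, then every
curve of `M` is `𝔓𝔯𝔦𝔪𝔢𝔰`-separated (`AbsCusp.isSeparated_of_forall_eq_top`: over a single point `x` with
`D_x = Π` every covering has exactly one point over `x`); in particular the typed Prop. 2.2 (ii)
`Prop_2_2_ii_model M` holds (its properness / scheme / MLF binders are not even used).
[cite: MochizukiAbsCusp2007, Prop 2.2 (ii) p.39] -/
theorem prop_2_2_ii_model_of_decomp_eq_top (M : CurveModel.{u})
    (hdecomp : ∀ (U : M.Curve) (x : M.Point U), M.decomp U x = ⊤)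
    (hone : ∀ (U : M.Curve) (x y : M.Point U), x = y) (hcusp : ∀ U : M.Curve, IsEmpty (M.cusps U).Cusp) :
    Prop_2_2_ii_model M := by
  intro X _ _ _
  refine isSeparated_of_forall_eq_top _ ?_ ?_
  · rintro (x | c) (y | c')
    · rw [hone X x y]
    · exact isEmptyElim c'
    · exact isEmptyElim c
    · exact isEmptyElim c
  · rintro (x | c)
    · exact hdecomp X x
    · exact isEmptyElim c

/-- **F-0044, unconditional instance at THE non-vacuous witness interface of record**: for every prime `p`,
the typed Prop. 2.2 (ii) `Prop_2_2_ii_model` HOLDS at the interface of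
`AbsTopIII.CurveModel.exists_facts_nonVacuous p` (named by `Exists.choose`; one curve over `ℚ_p` flagged proper
and scheme-like over an MLF base — so the row's binders fire —, `Π = G_{ℚ_p}`, one closed point with `D = Π`,
no cusps). [cite: MochizukiAbsCusp2007, Prop 2.2 (ii) p.39] -/
theorem prop_2_2_ii_model_nonVacuousModel (p : ℕ) [Fact p.Prime] :
    Prop_2_2_ii_model (CurveModel.exists_facts_nonVacuous p).choose := by
  obtain ⟨_hc, h⟩ := (CurveModel.exists_facts_nonVacuous p).choose_spec
  exact h.2.2.2.2.2.2.2.2.2.2.2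

end AbsCusp

end Literature.AnabelianGeometry.AbsoluteAnabelian
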